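import Summits.ValiantsHypothesis.ValiantsHypothesis.Theses.FreeFermionCLL
import Summits.ValiantsHypothesis.ValiantsHypothesis.Theses.DetQP
import Summits.ValiantsHypothesis.ValiantsHypothesis.Theses.PrincipalMinorColouring
import Summits.ValiantsHypothesis.ValiantsHypothesis.Theses.GrenetZeon
import Summits.ValiantsHypothesis.ValiantsHypothesis.Theorems.HubHub
import Literature.Computability.AlgebraicComplexity.ValiantClasses
import Literature.Computability.AlgebraicComplexity.ValiantConjectureProofs
import Literature.Computability.AlgebraicComplexity.VPDeterminantalQPProofs

/-!
# ValiantsHypothesis / FreeFermionCLL — `DcqpToVH` (hub glue)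

Item `stmt-ValiantsHypothesis-3786` (support, rank 9; shared verbatim by the routes `DetQP`,
`PrincipalMinorColouring`, `GrenetZeon` and `FreeFermionCLL`): if the affine determinantal
complexity `dc(per_n)` of the permanent over `ℂ` is not quasi-polynomially bounded, then Valiant's
hypothesis `VP_ℂ ≠ VNP_ℂ` holds.

Pure bookkeeping from four PROVED tree results:

* `Literature.Computability.AlgebraicComplexity.isQPBounded_determinantalComplexity_of_isVPFamily_holds`
  (`VP ⊆ VQP` = quasi-polynomial projections of `DET`: a `VP` family has quasi-polynomially
  bounded determinantal complexity; Bürgisser–Clausen–Shokrollahi 1997, Cor. (21.40) with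
  Thm. (21.27), (21.33), (21.36); Bürgisser 2000, Cor. 2.28 / Prop. 2.30);
* the hub lemma `Summit.ValiantsHypothesis.Hub.valiantsHypothesis_of_not_isVPFamily_per`
  (`Theorems/HubHub.lean`, item `stmt-ValiantsHypothesis-0317`);
* the renaming bridge `Literature.Computability.AlgebraicComplexity.mem_VP_ofFintype_iff_holds`
  (`perFamily ℂ ∈ VP ℂ ↔ IsVPFamily (fun n => perPoly (Fin n) ℂ)`; Bürgisser 2000, Rem. 2.2);
* Valiant's theorem `per ∈ VNP`, discharged as
  `Literature.Computability.AlgebraicComplexity.perFamily_mem_VNP_holds ℂ` (Valiant 1979;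
  Bürgisser 2000, Thm. 2.10).

Nothing else is here; the theorem is unconditional (no named-fact hypotheses).
-/

namespace Summit.ValiantsHypothesis.Theorems

/-- Settles `stmt-ValiantsHypothesis-3786` (`DcqpToVH`, route `FreeFermionCLL`; same statement in
routes `DetQP`, `PrincipalMinorColouring`, `GrenetZeon`):
`¬ IsQPBounded (fun n => dc(per_n)) → ValiantsHypothesis`. If `(per_n)_n` were a `VP` family over
`ℂ` (unbundled `IsVPFamily` form), then `dc(per_n)` would be quasi-polynomially bounded
(BCS 1997, Cor. (21.40)), contradicting the hypothesis; so `per ∉ VP`, and with `per ∈ VNP`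
(Valiant 1979) and the `ofFintype` renaming bridge (Bürgisser 2000, Rem. 2.2) the hub lemma gives
`VP ℂ ≠ VNP ℂ`. [folklore] -/
theorem dcqpToVH_proof :
    Summit.ValiantsHypothesis.ValiantsHypothesis.Theses.FreeFermionCLL.DcqpToVH := by
  unfold Summit.ValiantsHypothesis.ValiantsHypothesis.Theses.FreeFermionCLL.DcqpToVH
  intro hnqp
  refine Summit.ValiantsHypothesis.Hub.valiantsHypothesis_of_not_isVPFamily_per ?_
    (Literature.Computability.AlgebraicComplexity.mem_VP_ofFintype_iff_holds _)
    (Literature.Computability.AlgebraicComplexity.perFamily_mem_VNP_holds ℂ)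
  intro hVP
  exact hnqp
    (Literature.Computability.AlgebraicComplexity.isQPBounded_determinantalComplexity_of_isVPFamily_holds
      (fun n => Literature.Computability.AlgebraicComplexity.perPoly (Fin n) ℂ) hVP)

/-- The same statement under route `DetQP`'s name of the shared item `stmt-ValiantsHypothesis-3786`
(`DetQP.DcqpToVH`, literally the same term as `FreeFermionCLL.DcqpToVH`). [folklore] -/
theorem dcqpToVH_proof_detQP :
    Summit.ValiantsHypothesis.ValiantsHypothesis.Theses.DetQP.DcqpToVH :=
  dcqpToVH_proof

/-- The same statement under route `PrincipalMinorColouring`'s name of the shared item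
`stmt-ValiantsHypothesis-3786` (`PrincipalMinorColouring.DcqpToVH`, literally the same term).
[folklore] -/
theorem dcqpToVH_proof_principalMinorColouring :
    Summit.ValiantsHypothesis.ValiantsHypothesis.Theses.PrincipalMinorColouring.DcqpToVH :=
  dcqpToVH_proof

/-- The same statement under route `GrenetZeon`'s name of the shared item
`stmt-ValiantsHypothesis-3786` (`GrenetZeon.DcqpToVH`, literally the same term). [folklore] -/
theorem dcqpToVH_proof_grenetZeon :
    Summit.ValiantsHypothesis.ValiantsHypothesis.Theses.GrenetZeon.DcqpToVH :=
  dcqpToVH_proof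

end Summit.ValiantsHypothesis.Theorems
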